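import Summits.ABC.IUTFork.ForkSwitch
import HarnessLib

/-!
# INSTANCE FORMS for the hypothesis binder `LanaModel.MainGoal` (LANA's main goal (9-1) at every point of a one-model carrier)

PROOF-ONLY companion (no `def`, no `structure`, no `instance`, no notation; abc-iut cell, block F seat
abc-iut-f-056 gen 6, KEY row INST59E of director-abc g4 2026-08-27T08:16Z; FACT-LIST row F-1903).
`Summit.ABC.IUTFork.LanaModel.MainGoal` (`ForkSwitch.lean`) is a PARAMETRISED `def … : Prop` — "(9-1) at every
point `P` of the carrier" — whose universal closure is REFUTED (`LanaModel.not_forall_mainGoal`,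
F6ForkDecisionsRepresented; `LanaModel.exists_indeterminacies_not_mainGoal`, ForkModelNonVacuity) and whose
satisfiability is recorded as the `∃`-witness `LanaModel.exists_mainGoal` (ForkModelNonVacuity: a record whose
hull volume IS the `q`-volume at every point). The tree's inhabited `LanaModel`s are ANONYMOUS records built
inside `LanaModel.exists_parameterRecord` (private), so a CLOSED instance-form theorem at a named model is not
expressible without a new `def`; what this file adds are the CONDITIONAL instance forms over ALL models —
conclusion head = the declaration, fully qualified — naming the exact per-point condition that yields (9-1):

* `mainGoal_of_forall_vol_eq` — at each point some suitable `S` has `vol(1·S) = vol({q̲_v O_v})`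
  (`EtaSetting.mainGoal_iff_vol`);
* `mainGoal_of_forall_represented` — at each point "`−|log(q)|` is one of the possible values"
  (`EtaSetting.mainGoal_iff_represented`, LANA §9.3: "(9-1) indicates that … the rigidified `q`-pilot is
  represented in the output regions");
* `mainGoal_of_forall_vol_eq_negAbsLogq` — the same read through the model's own field `volq_eq`
  (§8.1 (a): the `q`-region's volume is `−|log(q)|`): some region `1·S` has log-volume `−|log(q)|`.

HONEST FRAMING: these are bookkeeping implications between OUR typed fork-level predicates; nothing about
[IUTchIII] Theorem 3.11 / Corollary 3.12 or LANA's actual (9-1) is decided ("not manifestly false … we do not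
have a proof of (9-1) at this time", LANA §10.5 p. 49); typed ≠ proved; no side is taken on [IUTchIII] Cor.
3.12; nothing here asserts abc proved or refuted.
-/

namespace Summit.ABC.IUTFork.LanaModel

/-- **F-1903, conditional instance (all models): (9-1) from equality of volumes at every point.** If at
every point `P` some suitable structure `S` has `vol(1·S) = vol({q̲_v O_v})`, the model satisfies `MainGoal`
(pointwise `EtaSetting.mainGoal_iff_vol`: "there exists some suitable `S` such that `η_q = η^{anab}_S`" ⟺
equality of the two classes in `ℝ^ss` ⟺ equal volumes). The `∀`-refuter's record
(`exists_indeterminacies_not_mainGoal`) has hull volume `C_Θ·|log(q)| < −|log(q)|`, so NO `1·S` reaches the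
`q`-volume there. [cite: LANA2026Report, §9.2 (9-1) p. 46] -/
theorem mainGoal_of_forall_vol_eq (M : LanaModel)
    (h : ∀ P, ∃ s : (M.eta P).S, (M.eta P).vol ((M.eta P).LGP s) = (M.eta P).vol (M.eta P).qRegion) :
    Summit.ABC.IUTFork.LanaModel.MainGoal M :=
  fun P => (M.eta P).mainGoal_iff_vol.mpr (h P)

/-- **F-1903, conditional instance (all models): (9-1) from `Represented` at every point** (LANA §9.3 p. 46:
"(9-1) indicates that … at the level of degree (log-volume), the rigidified `q`-pilot is represented in the
output regions" — pointwise `EtaSetting.mainGoal_iff_represented`; `Represented` is skel VIII's reading of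
[IUTchIII] Step (xi-f)). [cite: LANA2026Report, §9.3 p. 46] -/
theorem mainGoal_of_forall_represented (M : LanaModel)
    (h : ∀ P, (M.eta P).toOutputRegions.Represented) :
    Summit.ABC.IUTFork.LanaModel.MainGoal M :=
  fun P => (M.eta P).mainGoal_iff_represented.mpr (h P)

/-- **F-1903, conditional instance through the model's own normalisation** (§8.1 (a): the `q`-pilot region's
volume is `−|log(q)|`, field `volq_eq`): if at every point some region `1·S` has log-volume `−|log(q)|` of that
point's Thm-1.10 data, the model satisfies `MainGoal`. This is the shape of the tree's `∃`-witness
`LanaModel.exists_mainGoal` (there `vol(1·S) = −|log(Θ)| := −|log(q)|` at every point).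
[cite: LANA2026Report, §8.1 (a) p. 40, §9.2 (9-1) p. 46] -/
theorem mainGoal_of_forall_vol_eq_negAbsLogq (M : LanaModel)
    (h : ∀ P, ∃ s : (M.eta P).S, (M.eta P).vol ((M.eta P).LGP s) = -(M.T.X P).absLogq) :
    Summit.ABC.IUTFork.LanaModel.MainGoal M :=
  mainGoal_of_forall_vol_eq M fun P => by
    obtain ⟨s, hs⟩ := h P
    exact ⟨s, hs.trans (M.volq_eq P).symm⟩

end Summit.ABC.IUTFork.LanaModel
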